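import Literature.NumberTheory.LocalFields.UnramifiedQuadraticNormFixedPoints
import HarnessLib

/-!
# Norm fibres modulo `𝔪^k` in an unramified quadratic extension of complete discrete valuation rings:
# `#{x mod 𝔪^k : x σ̄(x) = r̄} = q^{k-1}(q + 1)` (Serre, *Local Fields*, Ch. V §2, Prop. 3; the count behind Flicker 1998 §6 p. 95) — FILE 2

Topic `NumberTheory/LocalFields`, namespace `Literature.NumberTheory.LocalFields.UnramifiedQuadraticNorm`.  THEOREMS ONLY: no definition, no named
fact, no instance, no notation, no `sorry`.  Cell `pub/hodgecm-mathlib`, F0∕P3a road «D-N7-inert», brick (L5-c) FILE 2 of the H-side count (L5)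
[Flicker1998UnitaryFL §6 p. 95 + REMARK] (B-p10 (g24) PRE-CENSUS bf72064b4f0257e1), over FILE 1 ★ `UnramifiedQuadraticNormFixedPoints`
(`|R ⧸ 𝔪^k| = |𝓀|^k`, `|Fix(σ̄_k)| = q^k`, σ-fixed lifts).  HC_CM is proved only modulo the printed citations until rung 0 closes; nothing printed is a
letter here — this is elementary finite counting.

SETTING.  `R` a discrete valuation ring, complete for `𝔪` (§5), FINITE residue field `𝓀` with `|𝓀| = q²`; `σ` a ring involution of `R` moving some
element by a unit (`σ a − a ∈ Rˣ`).  Model: `R = 𝒪_w`, `σ = σ_w` at a non-split unramified place `w ∣ v` of a CM field, `q = |𝓀_v|`.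

* §4 UNITS (`x mod 𝔪^k` is a unit iff `x` is, `k ≥ 1`): `|non-units| = |𝓀|^{k−1}` (the kernel of `R ⧸ 𝔪^k → R ⧸ 𝔪`),
  `|units| + |𝓀|^{k−1} = |𝓀|^k`; FIXED NON-UNITS `= q^{k−1}` (reduction `Fix(σ̄_k) → Fix(σ̄_1)` is ONTO by σ-fixed lifts, kernel = fixed non-units,
  `|Fix(σ̄_j)| = q^j`); `2 ≤ q`.
* §5 THE NORM `u ↦ u σ̄_k(u)` maps `(R ⧸ 𝔪^k)ˣ` ONTO its `σ̄_k`-fixed part (★ `exists_mul_map_eq_of_finite_residueField`: every `σ`-fixed unit of `R` is a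
  norm, after a σ-fixed lift) with all fibres cosets of the kernel, of size `|units| ∕ |fixed units| = q^{2k−2}(q²−1) ∕ (q^{k−1}(q−1)) = q^{k−1}(q+1)`:
  **`natCard_norm_fibre_quotient_pow`** — for `k ≥ 1` and a `σ`-fixed unit `r` of `R`,
  `Nat.card {x : R ⧸ 𝔪^k // x · σ̄_k x = r̄} = q^{k−1}(q+1)`; in particular (`r = 1`) the norm-one classes `E¹_w mod 𝔪_w^k` number `q^{k−1}(q+1)`.
This is the gluing count `w(j) = q^{j−1}(q+1)` of the eigenframe description of self-dual `γ`-stable lattices in a hermitian plane (PRE-CENSUS §2 (iii)–(iv)),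
and Mars' index `[R_E^× : R_E(j)^×]` in Flicker's REMARK has the same value.

## References
* [Serre1979] J.-P. Serre, *Local Fields*, GTM 67 (1979), Ch. V §2 Prop. 1–3 and Corollary, Ch. II §3 Prop. 5, Ch. IV §2 Prop. 6.
* [Flicker1998UnitaryFL] Y. Z. Flicker, *Elementary proof of the fundamental lemma for a unitary group*, Canad. J. Math. 50 (1998), §6 p. 95 and REMARK.
-/

set_option autoImplicit false

namespace Literature.NumberTheory.LocalFields.UnramifiedQuadraticNorm

open Literature.LinearAlgebra.Matrix.HermitianFormsHensel Literature.NumberTheory.GaloisRepresentations IsLocalRing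

universe u

variable {R : Type u} [CommRing R] (σ : R →+* R)

/-! ## §3′ Two generic counting lemmas (plumbing) -/

section Generic

/-- Counting along a homomorphism: for an additive hom `f` and a finite additive subgroup `S`, `|S| = |f(S)| · |S ∩ ker f|`. [folklore] -/
private theorem natCard_eq_natCard_map_mul {A B : Type*} [AddCommGroup A] [AddCommGroup B] (f : A →+ B) (S : AddSubgroup A) [Finite S] :
    Nat.card S = Nat.card (S.map f) * Nat.card ↥(f.ker ⊓ S) := by
  rw [AddSubgroup.card_eq_card_quotient_mul_card_addSubgroup ((f.restrict S).ker)]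
  congr 1
  · rw [Nat.card_congr (QuotientAddGroup.quotientKerEquivRange (f.restrict S)).toEquiv, AddMonoidHom.restrict_range]
  · rw [AddMonoidHom.ker_restrict, ← AddSubgroup.inf_addSubgroupOf_right]
    exact Nat.card_congr (AddSubgroup.addSubgroupOfEquivOfLe (inf_le_right : f.ker ⊓ S ≤ S)).toEquiv

/-- `|Mˣ| = |{x : M // IsUnit x}|`. [folklore] -/
private theorem natCard_units_eq_natCard_isUnit (M : Type*) [Monoid M] : Nat.card Mˣ = Nat.card {x : M // IsUnit x} :=
  Nat.card_eq_of_bijective (fun u : Mˣ => (⟨(u : M), u.isUnit⟩ : {x : M // IsUnit x}))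
    ⟨fun _ _ h => Units.ext (congrArg Subtype.val h), fun x => ⟨x.2.unit, Subtype.ext x.2.unit_spec⟩⟩

end Generic

/-! ## §4 Units and `σ̄`-fixed units of `R ⧸ 𝔪^k` -/

section Units

variable [IsDomain R] [IsDiscreteValuationRing R]

/-- For `k ≥ 1`, `x mod 𝔪^k` is a unit iff `x` is (a local ring: `x y ≡ 1 (𝔪)` forces `x ∉ 𝔪`). [folklore] -/
private theorem isUnit_mk_pow_iff {k : ℕ} (hk : 1 ≤ k) (x : R) : IsUnit (Ideal.Quotient.mk (maximalIdeal R ^ k) x) ↔ IsUnit x := by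
  refine ⟨fun h => ?_, fun h => h.map _⟩
  obtain ⟨y, hy⟩ := h.exists_right_inv
  obtain ⟨y, rfl⟩ := Ideal.Quotient.mk_surjective y
  rw [← map_mul, ← (Ideal.Quotient.mk (maximalIdeal R ^ k)).map_one, Ideal.Quotient.eq] at hy
  have hxy : x * y - 1 ∈ maximalIdeal R := Ideal.pow_le_self (Nat.one_le_iff_ne_zero.1 hk) hy
  by_contra hx
  have hxm : x * y ∈ maximalIdeal R := (maximalIdeal R).mul_mem_right y ((mem_maximalIdeal _).2 (mem_nonunits_iff.2 hx))
  have h1 : (1 : R) ∈ maximalIdeal R := by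
    have := (maximalIdeal R).sub_mem hxm hxy
    rwa [sub_sub_cancel] at this
  exact (maximalIdeal.isMaximal R).ne_top ((Ideal.eq_top_iff_one _).2 h1)

/-- `x mod 𝔪^k` is a NON-unit iff it dies in `R ⧸ 𝔪` under `Ideal.Quotient.factor` (`x ∈ 𝔪`), `k ≥ 1`. [folklore] -/
private theorem not_isUnit_iff_factor_eq_zero {k : ℕ} (hk : 1 ≤ k) (x : R ⧸ maximalIdeal R ^ k) :
    ¬ IsUnit x ↔ Ideal.Quotient.factor (S := maximalIdeal R ^ k) (T := maximalIdeal R ^ 1) (Ideal.pow_le_pow_right hk) x = 0 := by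
  obtain ⟨x, rfl⟩ := Ideal.Quotient.mk_surjective x
  rw [isUnit_mk_pow_iff hk, Ideal.Quotient.factor_mk, Ideal.Quotient.eq_zero_iff_mem, pow_one, mem_maximalIdeal, mem_nonunits_iff]

/-- **`|non-units of R ⧸ 𝔪^k| = |𝓀|^{k−1}`** (`k ≥ 1`): the non-units form the kernel of `R ⧸ 𝔪^k → R ⧸ 𝔪`, of index `|𝓀|`. [cite: Serre1979, Ch. II §3 Prop. 5] -/
theorem natCard_nonunits_quotient_pow [Finite (ResidueField R)] {k : ℕ} (hk : 1 ≤ k) :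
    Nat.card {x : R ⧸ maximalIdeal R ^ k // ¬ IsUnit x} = Nat.card (ResidueField R) ^ (k - 1) := by
  haveI := CompleteLocalRing.finite_quotient_maximalIdeal_pow (R := R) k
  set φ := Ideal.Quotient.factor (S := maximalIdeal R ^ k) (T := maximalIdeal R ^ 1) (Ideal.pow_le_pow_right hk) with hφ
  have hsurj : Function.Surjective φ.toAddMonoidHom := fun y => by
    obtain ⟨y, rfl⟩ := Ideal.Quotient.mk_surjective y
    exact ⟨Ideal.Quotient.mk _ y, Ideal.Quotient.factor_mk (S := maximalIdeal R ^ k) (T := maximalIdeal R ^ 1) (Ideal.pow_le_pow_right hk) y⟩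
  -- `|R ⧸ 𝔪^k| = |R ⧸ 𝔪| · |ker φ|`
  have hcard : Nat.card (R ⧸ maximalIdeal R ^ k) = Nat.card (R ⧸ maximalIdeal R ^ 1) * Nat.card φ.toAddMonoidHom.ker := by
    rw [AddSubgroup.card_eq_card_quotient_mul_card_addSubgroup φ.toAddMonoidHom.ker,
      Nat.card_congr (QuotientAddGroup.quotientKerEquivOfSurjective φ.toAddMonoidHom hsurj).toEquiv]
  have hker : Nat.card φ.toAddMonoidHom.ker = Nat.card {x : R ⧸ maximalIdeal R ^ k // ¬ IsUnit x} :=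
    Nat.card_congr (Equiv.subtypeEquivRight fun x => by rw [AddMonoidHom.mem_ker, not_isUnit_iff_factor_eq_zero hk]; rfl)
  rw [natCard_quotient_maximalIdeal_pow, natCard_quotient_maximalIdeal_pow, pow_one, hker] at hcard
  have hq : 0 < Nat.card (ResidueField R) := Nat.card_pos
  obtain ⟨j, rfl⟩ := Nat.exists_eq_add_of_le' hk
  rw [Nat.add_sub_cancel]
  rw [show Nat.card (ResidueField R) ^ (j + 1) = Nat.card (ResidueField R) * Nat.card (ResidueField R) ^ j from pow_succ' _ _] at hcard
  exact (Nat.eq_of_mul_eq_mul_left hq hcard).symm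

/-- **`|(R ⧸ 𝔪^k)ˣ| + |𝓀|^{k−1} = |𝓀|^k`** (`k ≥ 1`). [cite: Serre1979, Ch. II §3 Prop. 5; Ch. IV §2 Prop. 6] -/
theorem natCard_isUnit_quotient_pow_add [Finite (ResidueField R)] {k : ℕ} (hk : 1 ≤ k) :
    Nat.card {x : R ⧸ maximalIdeal R ^ k // IsUnit x} + Nat.card (ResidueField R) ^ (k - 1) = Nat.card (ResidueField R) ^ k := by
  classical
  haveI := CompleteLocalRing.finite_quotient_maximalIdeal_pow (R := R) k
  rw [← natCard_nonunits_quotient_pow hk, ← Nat.card_sum, Nat.card_congr (Equiv.sumCompl fun x : R ⧸ maximalIdeal R ^ k => IsUnit x),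
    natCard_quotient_maximalIdeal_pow]

end Units

section FixedUnits

variable [IsDomain R] [IsDiscreteValuationRing R] [Finite (ResidueField R)] (hσ : ∀ a, σ (σ a) = a) {a : R} (ha : IsUnit (σ a - a))
  {q : ℕ} (hq : Nat.card (ResidueField R) = q ^ 2)

include hσ ha hq in
/-- **`|σ̄_k-fixed NON-units of R ⧸ 𝔪^k| = q^{k−1}`** (`k ≥ 1`): reduction `Fix(σ̄_k) → Fix(σ̄_1)` is ONTO (σ-fixed lifts, `exists_fixed_sub_mem`) with kernel the fixed
non-units, and `|Fix(σ̄_j)| = q^j`. [cite: Serre1979, Ch. V §2 Prop. 2–3] -/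
theorem natCard_fixed_nonunits_quotient_pow {k : ℕ} (hk : 1 ≤ k) :
    Nat.card {x : R ⧸ maximalIdeal R ^ k //
      Ideal.quotientMap (maximalIdeal R ^ k) σ (maximalIdeal_pow_le_comap σ hσ k) x = x ∧ ¬ IsUnit x} = q ^ (k - 1) := by
  haveI := CompleteLocalRing.finite_quotient_maximalIdeal_pow (R := R) k
  haveI := CompleteLocalRing.finite_quotient_maximalIdeal_pow (R := R) 1
  set σk := Ideal.quotientMap (maximalIdeal R ^ k) σ (maximalIdeal_pow_le_comap σ hσ k) with hσk
  set σ1 := Ideal.quotientMap (maximalIdeal R ^ 1) σ (maximalIdeal_pow_le_comap σ hσ 1) with hσ1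
  set φ := Ideal.Quotient.factor (S := maximalIdeal R ^ k) (T := maximalIdeal R ^ 1) (Ideal.pow_le_pow_right hk) with hφ
  have hφσ : ∀ x, φ (σk x) = σ1 (φ x) := fun x => by
    obtain ⟨x, rfl⟩ := Ideal.Quotient.mk_surjective x
    rw [Ideal.quotientMap_mk, Ideal.Quotient.factor_mk, Ideal.Quotient.factor_mk, Ideal.quotientMap_mk]
  -- the fixed subring of `σ̄_k`, as an additive subgroup
  set Fk := (σk.eqLocus (RingHom.id _)).toAddSubgroup with hFk
  have hmemFk : ∀ x, x ∈ Fk ↔ σk x = x := fun x => RingHom.mem_eqLocus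
  have hmap : Fk.map φ.toAddMonoidHom = (σ1.eqLocus (RingHom.id _)).toAddSubgroup := by
    ext y
    constructor
    · rintro ⟨x, hx, rfl⟩
      have hx' : σk x = x := (hmemFk x).1 hx
      show σ1 (φ x) = φ x
      rw [← hφσ, hx']
    · intro hy
      have hy' : σ1 y = y := hy
      obtain ⟨y₀, rfl⟩ := Ideal.Quotient.mk_surjective y
      rw [Ideal.quotientMap_mk, Ideal.Quotient.eq] at hy'
      obtain ⟨r, hr, hry⟩ := exists_fixed_sub_mem σ hσ ha hy'
      refine ⟨Ideal.Quotient.mk _ r, (hmemFk _).2 (by rw [Ideal.quotientMap_mk, hr]), ?_⟩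
      show φ (Ideal.Quotient.mk _ r) = Ideal.Quotient.mk _ y₀
      rw [Ideal.Quotient.factor_mk, Ideal.Quotient.eq]; exact hry
  have hcount := natCard_eq_natCard_map_mul φ.toAddMonoidHom Fk
  rw [hmap] at hcount
  have hFk_card : Nat.card Fk = q ^ k := by
    rw [← natCard_fixed_quotient_pow σ hσ ha hq k]
    exact Nat.card_congr (Equiv.subtypeEquivRight fun x => hmemFk x)
  have hF1_card : Nat.card (σ1.eqLocus (RingHom.id _)).toAddSubgroup = q ^ 1 := by
    rw [← natCard_fixed_quotient_pow σ hσ ha hq 1]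
    exact Nat.card_congr (Equiv.subtypeEquivRight fun x => RingHom.mem_eqLocus)
  have hker : Nat.card ↥(φ.toAddMonoidHom.ker ⊓ Fk) = Nat.card {x : R ⧸ maximalIdeal R ^ k // σk x = x ∧ ¬ IsUnit x} := by
    refine Nat.card_congr (Equiv.subtypeEquivRight fun x => ?_)
    rw [AddSubgroup.mem_inf, AddMonoidHom.mem_ker, hmemFk, not_isUnit_iff_factor_eq_zero hk, and_comm]
    rfl
  rw [hFk_card, hF1_card, hker, pow_one] at hcount
  have hqpos : 0 < q := by
    rcases Nat.eq_zero_or_pos q with h0 | h0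
    · exfalso
      rw [h0, zero_pow two_ne_zero] at hq
      exact (Nat.card_pos (α := ResidueField R)).ne' hq
    · exact h0
  obtain ⟨j, rfl⟩ := Nat.exists_eq_add_of_le' hk
  rw [Nat.add_sub_cancel]
  rw [show q ^ (j + 1) = q * q ^ j from pow_succ' _ _] at hcount
  exact (Nat.eq_of_mul_eq_mul_left hqpos hcount).symm

include hq in
/-- `2 ≤ q` when `|𝓀| = q²` (a field has at least two elements). [folklore] -/
private theorem two_le_of_natCard_residueField_eq_sq : 2 ≤ q := by
  have h1 : 1 < Nat.card (ResidueField R) := Finite.one_lt_card_iff_nontrivial.2 inferInstance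
  rw [hq] at h1
  by_contra hlt
  interval_cases q <;> simp at h1

end FixedUnits

/-! ## §5 The norm `u ↦ u σ̄(u)` on `(R ⧸ 𝔪^k)ˣ`: onto the fixed units, fibres of size `q^{k−1}(q+1)` -/

section Norm

variable [IsDomain R] [IsDiscreteValuationRing R] [Finite (ResidueField R)] [IsAdicComplete (maximalIdeal R) R]
  (hσ : ∀ a, σ (σ a) = a) {a : R} (ha : IsUnit (σ a - a)) {q : ℕ} (hq : Nat.card (ResidueField R) = q ^ 2)

include hσ ha hq in
/-- **THE NORM FIBRES MODULO `𝔪^k`.**  For `k ≥ 1` and a `σ`-fixed unit `r` of `R`: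
`#{x ∈ R ⧸ 𝔪^k : x · σ̄_k(x) = r̄} = q^{k−1}(q + 1)`.
The norm `u ↦ u σ̄_k(u)` is a homomorphism of the finite abelian group `(R ⧸ 𝔪^k)ˣ` ONTO its `σ̄_k`-fixed part (every `σ`-fixed unit of `R` is a norm, ★
`exists_mul_map_eq_of_finite_residueField`, after a `σ`-fixed lift `exists_fixed_sub_mem`), so every fibre has `|(R ⧸ 𝔪^k)ˣ| ∕ |fixed units| =
q^{2k−2}(q²−1) ∕ (q^{k−1}(q−1)) = q^{k−1}(q+1)` elements (§4: `natCard_isUnit_quotient_pow_add`, `natCard_fixed_nonunits_quotient_pow`, `natCard_fixed_quotient_pow`).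
[cite: Serre1979, Ch. V §2 Prop. 3 and Corollary] [cite: Flicker1998UnitaryFL, §6 p. 95 REMARK] -/
theorem natCard_norm_fibre_quotient_pow {k : ℕ} (hk : 1 ≤ k) {r : R} (hr : IsUnit r) (hσr : σ r = r) :
    Nat.card {x : R ⧸ maximalIdeal R ^ k //
      x * Ideal.quotientMap (maximalIdeal R ^ k) σ (maximalIdeal_pow_le_comap σ hσ k) x = Ideal.Quotient.mk _ r} = q ^ (k - 1) * (q + 1) := by
  classical
  haveI := CompleteLocalRing.finite_quotient_maximalIdeal_pow (R := R) k
  set I := maximalIdeal R ^ k with hI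
  set σk := Ideal.quotientMap I σ (maximalIdeal_pow_le_comap σ hσ k) with hσk
  have hσk_mk : ∀ x : R, σk (Ideal.Quotient.mk I x) = Ideal.Quotient.mk I (σ x) := fun x => Ideal.quotientMap_mk
  have hσkσk : ∀ x, σk (σk x) = x := quotientMap_quotientMap σ hσ k
  -- the norm homomorphism on units
  let N : (R ⧸ I)ˣ →* (R ⧸ I)ˣ :=
    { toFun := fun u => u * Units.map σk.toMonoidHom u
      map_one' := by rw [map_one, mul_one]
      map_mul' := fun u v => by rw [map_mul]; exact mul_mul_mul_comm _ _ _ _ }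
  have hNval : ∀ u : (R ⧸ I)ˣ, ((N u : (R ⧸ I)ˣ) : R ⧸ I) = (u : R ⧸ I) * σk u := fun u => by
    show ((u * Units.map σk.toMonoidHom u : (R ⧸ I)ˣ) : R ⧸ I) = _
    rw [Units.val_mul, Units.coe_map]; rfl
  -- RANGE = fixed units
  have hrange : N.range = (Units.map σk.toMonoidHom).eqLocus (MonoidHom.id _) := by
    ext u
    constructor
    · rintro ⟨v, rfl⟩
      show Units.map σk.toMonoidHom (N v) = N v
      ext
      rw [Units.coe_map, hNval]
      show σk ((v : R ⧸ I) * σk v) = _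
      rw [map_mul, hσkσk, mul_comm]
    · intro hu
      have hu' : σk (u : R ⧸ I) = u := by
        have := congrArg (fun w : (R ⧸ I)ˣ => (w : R ⧸ I)) (show Units.map σk.toMonoidHom u = u from hu)
        simpa only [Units.coe_map, RingHom.toMonoidHom_eq_coe, MonoidHom.coe_coe] using this
      obtain ⟨x, hx⟩ := Ideal.Quotient.mk_surjective (u : R ⧸ I)
      have hfix : σ x - x ∈ I := by rw [← Ideal.Quotient.eq, ← hσk_mk, hx, hu']
      obtain ⟨r', hr', hr'x⟩ := exists_fixed_sub_mem σ hσ ha hfix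
      have hr'u : Ideal.Quotient.mk I r' = u := by rw [← hx]; exact (Ideal.Quotient.eq).2 hr'x
      have hr'unit : IsUnit r' := (isUnit_mk_pow_iff hk r').1 (by rw [hr'u]; exact u.isUnit)
      obtain ⟨s, hs⟩ := exists_mul_map_eq_of_finite_residueField σ hσ ha r' hr'unit hr'
      have hsunit : IsUnit (Ideal.Quotient.mk I s) := by
        refine (isUnit_mk_pow_iff hk s).2 (isUnit_of_mul_isUnit_left (y := σ s) ?_)
        rw [hs]; exact hr'unit
      refine ⟨hsunit.unit, Units.ext ?_⟩
      rw [hNval, hsunit.unit_spec, hσk_mk, ← map_mul, hs, hr'u]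
  -- |units| = |range| * |ker|
  have hcard : Nat.card (R ⧸ I)ˣ = Nat.card N.range * Nat.card N.ker := by
    rw [Subgroup.card_eq_card_quotient_mul_card_subgroup N.ker, Nat.card_congr (QuotientGroup.quotientKerEquivRange N).toEquiv]
  -- |units| from §4
  have hU : Nat.card (R ⧸ I)ˣ + (q ^ 2) ^ (k - 1) = (q ^ 2) ^ k := by
    rw [natCard_units_eq_natCard_isUnit, ← hq]; exact natCard_isUnit_quotient_pow_add hk
  -- |range| = |fixed units| = q^k − q^{k−1}
  have hF : Nat.card N.range + q ^ (k - 1) = q ^ k := by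
    rw [hrange, ← natCard_fixed_nonunits_quotient_pow σ hσ ha hq hk, ← natCard_fixed_quotient_pow σ hσ ha hq k]
    have e1 : Nat.card ↥((Units.map σk.toMonoidHom).eqLocus (MonoidHom.id _)) = Nat.card {x : R ⧸ I // σk x = x ∧ IsUnit x} := by
      refine Nat.card_eq_of_bijective (fun u => ⟨((u : (R ⧸ I)ˣ) : R ⧸ I), ⟨?_, (u : (R ⧸ I)ˣ).isUnit⟩⟩) ⟨fun u v h => ?_, fun x => ?_⟩
      · have := congrArg (fun w : (R ⧸ I)ˣ => (w : R ⧸ I)) (show Units.map σk.toMonoidHom (u : (R ⧸ I)ˣ) = u from u.2)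
        simpa only [Units.coe_map, RingHom.toMonoidHom_eq_coe, MonoidHom.coe_coe] using this
      · exact Subtype.ext (Units.ext (congrArg Subtype.val h))
      · refine ⟨⟨x.2.2.unit, ?_⟩, Subtype.ext x.2.2.unit_spec⟩
        show Units.map σk.toMonoidHom x.2.2.unit = x.2.2.unit
        ext; rw [Units.coe_map, x.2.2.unit_spec]; exact x.2.1
    have e2 : Nat.card {x : R ⧸ I // σk x = x ∧ IsUnit x} + Nat.card {x : R ⧸ I // σk x = x ∧ ¬ IsUnit x} =
        Nat.card {x : R ⧸ I // σk x = x} := by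
      rw [← Nat.card_congr (Equiv.subtypeSubtypeEquivSubtypeInter (fun x : R ⧸ I => σk x = x) (fun x => IsUnit x)),
        ← Nat.card_congr (Equiv.subtypeSubtypeEquivSubtypeInter (fun x : R ⧸ I => σk x = x) (fun x => ¬ IsUnit x)),
        ← Nat.card_sum, Nat.card_congr (Equiv.sumCompl (fun x : {x : R ⧸ I // σk x = x} => IsUnit x.1))]
    rw [e1]
    exact e2
  -- the fibre over `r̄` is a coset of the kernel
  have hru : IsUnit (Ideal.Quotient.mk I r) := (isUnit_mk_pow_iff hk r).2 hr
  have hfix_r : hru.unit ∈ N.range := by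
    rw [hrange]
    show Units.map σk.toMonoidHom hru.unit = hru.unit
    ext; rw [Units.coe_map, hru.unit_spec]; show σk _ = _; rw [hσk_mk, hσr]
  obtain ⟨x₀, hx₀⟩ := hfix_r
  have hfibre : Nat.card {x : R ⧸ I // x * σk x = Ideal.Quotient.mk I r} = Nat.card N.ker := by
    symm
    refine Nat.card_eq_of_bijective (fun u => ⟨((u : (R ⧸ I)ˣ) * x₀ : (R ⧸ I)ˣ), ?_⟩) ⟨fun u v h => ?_, fun x => ?_⟩
    · have hu : N u = 1 := u.2
      rw [← hNval, map_mul, hu, one_mul, hx₀, hru.unit_spec]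
    · have h' : ((u : (R ⧸ I)ˣ) * x₀ : (R ⧸ I)ˣ) = (v : (R ⧸ I)ˣ) * x₀ := Units.ext (congrArg Subtype.val h)
      exact Subtype.ext (mul_right_cancel h')
    · have hxu : IsUnit x.1 := isUnit_of_mul_isUnit_left (y := σk x.1) (by rw [x.2]; exact hru)
      refine ⟨⟨hxu.unit * x₀⁻¹, ?_⟩, Subtype.ext ?_⟩
      · show N (hxu.unit * x₀⁻¹) = 1
        rw [map_mul, map_inv, hx₀, mul_inv_eq_one]
        ext; rw [hNval, hxu.unit_spec, hru.unit_spec]; exact x.2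
      · show (((hxu.unit * x₀⁻¹) * x₀ : (R ⧸ I)ˣ) : R ⧸ I) = x.1
        rw [inv_mul_cancel_right, hxu.unit_spec]
  -- arithmetic
  rw [hfibre]
  have h2 := two_le_of_natCard_residueField_eq_sq (R := R) hq
  obtain ⟨j, rfl⟩ := Nat.exists_eq_add_of_le' hk
  rw [Nat.add_sub_cancel] at hU hF ⊢
  obtain ⟨d, rfl⟩ : ∃ d, q = d + 1 := ⟨q - 1, by omega⟩
  have hFU : Nat.card N.range = (d + 1) ^ j * d := by
    have e : (d + 1) ^ (j + 1) = (d + 1) ^ j * d + (d + 1) ^ j := by ring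
    rw [e] at hF; exact Nat.add_right_cancel hF
  have hUU : Nat.card (R ⧸ maximalIdeal R ^ (j + 1))ˣ = ((d + 1) ^ 2) ^ j * (d * (d + 2)) := by
    have e : ((d + 1) ^ 2) ^ (j + 1) = ((d + 1) ^ 2) ^ j * (d * (d + 2)) + ((d + 1) ^ 2) ^ j := by ring
    rw [e] at hU; exact Nat.add_right_cancel hU
  rw [hUU, hFU] at hcard
  have hpos : 0 < (d + 1) ^ j * d := Nat.mul_pos (pow_pos d.succ_pos j) (by omega)
  have e : ((d + 1) ^ 2) ^ j * (d * (d + 2)) = (d + 1) ^ j * d * ((d + 1) ^ j * (d + 1 + 1)) := by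
    rw [← pow_mul, show 2 * j = j + j from two_mul j, pow_add]; ring
  rw [e] at hcard
  exact (Nat.eq_of_mul_eq_mul_left hpos hcard).symm

end Norm

end Literature.NumberTheory.LocalFields.UnramifiedQuadraticNorm
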